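import Mathlib
import Summits.Schanuel.Schanuel.Theses.RigidCore
import Literature.NumberTheory.Transcendental.GammaPointsDense
import Literature.NumberTheory.Transcendental.SchanuelEclEmptyProofs

/-!
# Crux `MinimalCounterexampleInAcl` (stmt-Schanuel-0969), line `kernel-arithmetic-selection` — stub 4c: the ENDGAME of the sweep

Support theorem for the crux (S*) `RigidCore.MinimalCounterexampleInAcl`, registered stub
`stub_endgame` of the line skeleton `Lines/kernel-arithmetic-selection.lean`, verbatim.  This is
the place where the crux's own inductive hypothesis `SC(<n)` is spent.

**Statement.** Let `x ∈ ℂⁿ` be a first failure of Schanuel of rank `n` (`x` ℚ-linearly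
independent, `trdeg ℚ(x, eˣ) < n`, `SchanuelRank r` for all `r < n`), `m < n`, `q₁ … q_m ∈ ℚⁿ`
ℚ-linearly independent rational forms, and suppose every point `z` of the rational-direction
affine subspace `N = {z | ∀ j, q_j·z = q_j·x}` through `x` satisfies every ℚ-polynomial relation of
`(x, y)`, `y = eˣ`, at `(z, y)`.  Then `False`.

**Proof.** `κ_j := q_j·x` is a ℚ-linearly independent `m`-tuple (`linearIndependent_forms`) and a
positive power of each `e^{κ_j}` is a Laurent monomial in the `yᵢ = e^{xᵢ}` (`cexp_form_pow_mem`),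
so `e^κ` is algebraic over `K₀ := ℚ(κ, y)`.  Complete the `q_j` by `k := n − m` rational forms `r_b`
such that `z ↦ (r_b·z)_b` maps `⋂ ker q_j` ONTO `ℂᵏ` (`exists_forms_compl`: a basis of the kernel
and a left inverse of its inclusion).  KEY (`algebraicIndependent_of_sweep`): `u_b := r_b·x` is an
algebraically independent family over `ℚ[κ, y]`: a relation `R(κ, u, y) = 0` pulls back along the
linear forms to a relation of `(x, y)`, hence by hypothesis holds at `(z, y)` for every `z ∈ N`,
i.e. `R(κ, T, y) = 0` for EVERY `T ∈ ℂᵏ`, so `R(κ, ·, y) ≡ 0` (`MvPolynomial.funext`).  Towers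
(`add_le_trdeg_adjoin_union`) give `trdeg ℚ(κ, y) + k ≤ trdeg ℚ(κ, y, u) ≤ trdeg ℚ(x, y) < n`, while
`SchanuelRank m` at `κ` gives `m ≤ trdeg ℚ(κ, e^κ) ≤ trdeg ℚ(κ, y, e^κ) = trdeg ℚ(κ, y)`
(`trdeg_le_of_isAlgebraic`); so `n = m + k ≤ trdeg ℚ(κ, y) + k < n`.

Main result: `stub_endgame`.  Helpers (all sorry-free, folklore): `exists_forms_compl`,
`linearIndependent_forms`, `cexp_form_pow_mem`, `algebraicIndependent_of_sweep`.

## References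

* [Kirby2010] J. Kirby, *Exponential algebraicity in exponential fields*, Bull. LMS 42 (2010)
  879–890, arXiv:0810.4285, §1 and Prop. 7.2 (essential counterexamples to Schanuel's conjecture;
  the rank bookkeeping of a minimal counterexample).
* [Lang1966] S. Lang, *Introduction to Transcendental Numbers*, Addison–Wesley 1966, Ch. III §1
  (Schanuel's conjecture; transcendence degree in towers).
-/

noncomputable section

set_option linter.dupNamespace false

open Complex Set

namespace Summit.Schanuel.Schanuel.Cruxes.MinimalCounterexampleInAcl.KernelArithmeticSelection

open Literature.NumberTheory.Transcendental (SchanuelRank add_le_trdeg_adjoin_union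
  trdeg_intermediateField_adjoin_mono trdeg_le_of_isAlgebraic)

/-- Rational complement of independent rational forms: if `q₁ … q_m ∈ ℚⁿ` are ℚ-linearly independent
there are `n − m` further rational forms `r_b` such that the joint map `v ↦ (q·v, r·v)` hits
`{0} × ℂ^{n−m}` — every prescribed value of the `r`-coordinates is attained on `⋂ ker q_j`. [folklore] -/
theorem exists_forms_compl {n m : ℕ} (q : Fin m → Fin n → ℚ) (hq : LinearIndependent ℚ q) :
    ∃ r : Fin (n - m) → Fin n → ℚ, ∀ T : Fin (n - m) → ℂ, ∃ v : Fin n → ℂ,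
      (∀ j, ∑ i, (q j i : ℂ) * v i = 0) ∧ ∀ b, ∑ i, (r b i : ℂ) * v i = T b := by
  classical
  let Φ : (Fin n → ℚ) →ₗ[ℚ] (Fin m → ℚ) := Matrix.mulVecLin q
  let W : Submodule ℚ (Fin n → ℚ) := LinearMap.ker Φ
  have hrank : Module.finrank ℚ (LinearMap.range Φ) = m := by
    have h := LinearIndependent.rank_matrix (M := (q : Matrix (Fin m) (Fin n) ℚ)) hq
    simpa [Matrix.rank] using h
  have hW : Module.finrank ℚ W = n - m := by
    have h : Module.finrank ℚ (LinearMap.range Φ) + Module.finrank ℚ W = n := by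
      simpa using LinearMap.finrank_range_add_finrank_ker Φ
    rw [hrank] at h
    omega
  let bW : Module.Basis (Fin (n - m)) ℚ W := Module.finBasisOfFinrankEq ℚ W hW
  obtain ⟨g, hg⟩ := LinearMap.exists_leftInverse_of_injective W.subtype (Submodule.ker_subtype W)
  let Ψ : (Fin n → ℚ) →ₗ[ℚ] (Fin (n - m) → ℚ) := bW.equivFun.toLinearMap ∘ₗ g
  -- the vectors `w_b ∈ W` dual to the forms `r_b := Ψ(e_•)_b`
  let w : Fin (n - m) → Fin n → ℚ := fun b => ((bW b : W) : Fin n → ℚ)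
  have hqw : ∀ j b, ∑ i, q j i * w b i = 0 := by
    intro j b
    have h0 : Φ (w b) = 0 := (bW b).2
    have := congr_fun h0 j
    simpa [Φ, Matrix.mulVec, dotProduct] using this
  have hΨw : ∀ b b', Ψ (w b) b' = if b = b' then 1 else 0 := by
    intro b b'
    have hgw : g (w b) = bW b := by
      have := LinearMap.congr_fun hg (bW b)
      simpa using this
    simp only [Ψ, LinearMap.coe_comp, Function.comp_apply, hgw, LinearEquiv.coe_coe,
      Module.Basis.equivFun_self]
  have hΨlin : ∀ (v : Fin n → ℚ) (b : Fin (n - m)), Ψ v b = ∑ i, Ψ (Pi.single i 1) b * v i := by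
    intro v b
    conv_lhs => rw [show v = ∑ i, v i • (Pi.single i (1 : ℚ) : Fin n → ℚ) from by
      ext i'; simp [Finset.sum_apply, Pi.single_apply]]
    rw [map_sum, Finset.sum_apply]
    refine Finset.sum_congr rfl fun i _ => ?_
    rw [map_smul, Pi.smul_apply, smul_eq_mul, mul_comm]
  refine ⟨fun b i => Ψ (Pi.single i 1) b, fun T => ⟨fun i => ∑ b, T b * (w b i : ℂ), ?_, ?_⟩⟩
  · intro j
    calc ∑ i, (q j i : ℂ) * ∑ b, T b * (w b i : ℂ)
        = ∑ b, T b * ((∑ i, q j i * w b i : ℚ) : ℂ) := by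
          push_cast
          simp_rw [Finset.mul_sum]
          rw [Finset.sum_comm]
          refine Finset.sum_congr rfl fun b _ => Finset.sum_congr rfl fun i _ => ?_
          ring
      _ = 0 := by simp [hqw]
  · intro b'
    calc ∑ i, ((Ψ (Pi.single i 1) b' : ℚ) : ℂ) * ∑ b, T b * (w b i : ℂ)
        = ∑ b, T b * ((∑ i, Ψ (Pi.single i 1) b' * w b i : ℚ) : ℂ) := by
          push_cast
          simp_rw [Finset.mul_sum]
          rw [Finset.sum_comm]
          refine Finset.sum_congr rfl fun b _ => Finset.sum_congr rfl fun i _ => ?_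
          ring
      _ = ∑ b, T b * (if b = b' then 1 else 0) := by
          refine Finset.sum_congr rfl fun b _ => ?_
          rw [← hΨlin (w b) b', hΨw b b']
          split_ifs <;> simp
      _ = T b' := by simp [Finset.sum_ite_eq']

/-- Independent rational forms of an independent tuple are independent: if `x` is ℚ-linearly
independent and the rational rows `q_j` are ℚ-linearly independent then so are the numbers
`κ_j = Σ_i q_{ji} x_i`. [folklore] -/
theorem linearIndependent_forms {n m : ℕ} {x : Fin n → ℂ} (hx : LinearIndependent ℚ x)
    {q : Fin m → Fin n → ℚ} (hq : LinearIndependent ℚ q) :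
    LinearIndependent ℚ (fun j => ∑ i, (q j i : ℂ) * x i) := by
  rw [Fintype.linearIndependent_iff] at hx hq ⊢
  intro c hc j
  have h1 : ∑ i, (∑ j, c j * q j i) • x i = 0 := by
    rw [← hc]
    simp_rw [Finset.smul_sum, Finset.sum_smul]
    rw [Finset.sum_comm]
    refine Finset.sum_congr rfl fun j _ => Finset.sum_congr rfl fun i _ => ?_
    rw [Rat.smul_def, Rat.smul_def]
    push_cast
    ring
  have h2 : ∀ i, ∑ j, c j * q j i = 0 := hx _ h1
  have h3 : ∑ j, c j • q j = 0 := by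
    funext i
    simp [Finset.sum_apply, h2]
  exact hq c h3 j

/-- A positive power of `exp (Σ cᵢ xᵢ)` (`cᵢ ∈ ℚ`) is a Laurent monomial in the `exp xᵢ`, hence lies
in any subfield containing them (clear the denominators of the `cᵢ`; `Complex.exp_sum`,
`Complex.exp_int_mul`). [folklore] -/
theorem cexp_form_pow_mem {n : ℕ} (x : Fin n → ℂ) (c : Fin n → ℚ) (K : IntermediateField ℚ ℂ)
    (hK : ∀ i, cexp (x i) ∈ K) :
    ∃ D : ℕ, 0 < D ∧ cexp (∑ i, (c i : ℂ) * x i) ^ D ∈ K := by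
  classical
  refine ⟨∏ i, (c i).den, Finset.prod_pos fun i _ => (c i).den_pos, ?_⟩
  set D : ℕ := ∏ i, (c i).den with hD
  have hQ : ∀ i, ∃ Q : ℤ, (D : ℂ) * (c i : ℂ) = (Q : ℂ) := by
    intro i
    refine ⟨(c i).num * ∏ i' ∈ Finset.univ.erase i, ((c i').den : ℤ), ?_⟩
    have hD' : (D : ℚ) = (c i).den * ∏ i' ∈ Finset.univ.erase i, ((c i').den : ℚ) := by
      rw [hD, ← Finset.mul_prod_erase Finset.univ (fun i' => (c i').den) (Finset.mem_univ i)]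
      push_cast
      rfl
    have h : (D : ℚ) * c i = ((c i).num * ∏ i' ∈ Finset.univ.erase i, ((c i').den : ℤ) : ℤ) := by
      rw [hD', mul_comm, ← mul_assoc, Rat.mul_den_eq_num]
      push_cast
      ring
    have := congrArg (fun r : ℚ => (r : ℂ)) h
    simpa only [Rat.cast_mul, Rat.cast_natCast, Rat.cast_intCast] using this
  choose Q hQ using hQ
  rw [← Complex.exp_nat_mul, Finset.mul_sum]
  have h : ∑ i, (D : ℂ) * ((c i : ℂ) * x i) = ∑ i, (Q i : ℂ) * x i := by
    refine Finset.sum_congr rfl fun i _ => ?_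
    rw [← mul_assoc, hQ i]
  rw [h, Complex.exp_sum]
  refine prod_mem fun i _ => ?_
  rw [Complex.exp_int_mul]
  exact zpow_mem (hK i) _

/-- **The transversal coordinates are algebraically independent over `ℚ[κ, y]`.** If every point
`z` of the affine subspace `N = {z | q·z = q·x}` satisfies every ℚ-polynomial relation of `(x, y)`
at `(z, y)`, and the rational forms `r_b` sweep `ℂᵏ` on `⋂ ker q_j`, then `u_b = r_b·x` is an
algebraically independent family over `ℚ[κ, y]`, `κ_j = q_j·x`: a relation `R(κ, u, y) = 0`
pulls back to a relation of `(x, y)`, hence holds at `(κ, t, y)` for all `t ∈ ℂᵏ`, so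
`R(κ, T, y) ≡ 0` (`MvPolynomial.funext`). [folklore] -/
theorem algebraicIndependent_of_sweep {n m k : ℕ} (x y : Fin n → ℂ)
    (q : Fin m → Fin n → ℚ) (r : Fin k → Fin n → ℚ)
    (hr : ∀ T : Fin k → ℂ, ∃ v : Fin n → ℂ,
      (∀ j, ∑ i, (q j i : ℂ) * v i = 0) ∧ ∀ b, ∑ i, (r b i : ℂ) * v i = T b)
    (hN : ∀ z : Fin n → ℂ, (∀ j, ∑ i, (q j i : ℂ) * z i = ∑ i, (q j i : ℂ) * x i) →
      ∀ p : MvPolynomial (Fin n ⊕ Fin n) ℚ, MvPolynomial.aeval (Sum.elim x y) p = 0 →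
        MvPolynomial.aeval (Sum.elim z y) p = 0) :
    AlgebraicIndependent
      (Algebra.adjoin ℚ (Set.range (fun j => ∑ i, (q j i : ℂ) * x i) ∪ Set.range y))
      (fun b => ∑ i, (r b i : ℂ) * x i) := by
  classical
  set κ : Fin m → ℂ := fun j => ∑ i, (q j i : ℂ) * x i with hκ
  set u : Fin k → ℂ := fun b => ∑ i, (r b i : ℂ) * x i with hu
  set R₀ : Subalgebra ℚ ℂ := Algebra.adjoin ℚ (Set.range κ ∪ Set.range y) with hR₀
  set w : Fin m ⊕ Fin n → ℂ := Sum.elim κ y with hw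
  have hwS : Set.range w = Set.range κ ∪ Set.range y := Set.Sum.elim_range _ _
  have hR₀w : R₀ = (MvPolynomial.aeval w).range := by
    rw [hR₀, ← hwS, Algebra.adjoin_range_eq_range_aeval]
  have hmem : ∀ c : MvPolynomial (Fin m ⊕ Fin n) ℚ, MvPolynomial.aeval w c ∈ R₀ := by
    intro c
    rw [hR₀w]
    exact ⟨c, rfl⟩
  let φ : MvPolynomial (Fin m ⊕ Fin n) ℚ →ₐ[ℚ] R₀ := (MvPolynomial.aeval w).codRestrict R₀ hmem
  have hφsurj : Function.Surjective φ.toRingHom := by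
    rintro ⟨c, hc⟩
    rw [hR₀w] at hc
    obtain ⟨P, hP⟩ := hc
    exact ⟨P, Subtype.ext hP⟩
  have hφcomp : (algebraMap R₀ ℂ).comp φ.toRingHom = (MvPolynomial.aeval w).toRingHom :=
    RingHom.ext fun c => rfl
  -- the linear forms and the substitution into `ℚ[X, Y]`
  let lin : (Fin n → ℚ) → MvPolynomial (Fin n ⊕ Fin n) ℚ := fun c =>
    ∑ i, MvPolynomial.C (c i) * MvPolynomial.X (Sum.inl i)
  have hlin : ∀ (c : Fin n → ℚ) (z : Fin n → ℂ),
      MvPolynomial.aeval (Sum.elim z y) (lin c) = ∑ i, (c i : ℂ) * z i := by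
    intro c z
    simp [lin, map_sum]
  let σ : Fin m ⊕ Fin n → MvPolynomial (Fin n ⊕ Fin n) ℚ :=
    Sum.elim (fun j => lin (q j)) (fun i => MvPolynomial.X (Sum.inr i))
  let τ : Fin k → MvPolynomial (Fin n ⊕ Fin n) ℚ := fun b => lin (r b)
  have hσ : ∀ z : Fin n → ℂ, (∀ j, ∑ i, (q j i : ℂ) * z i = ∑ i, (q j i : ℂ) * x i) →
      (fun v => MvPolynomial.aeval (Sum.elim z y) (σ v)) = w := by
    intro z hz
    funext v
    rcases v with j | i
    · simp only [σ, Sum.elim_inl, hlin, hw, hκ]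
      exact hz j
    · simp [σ, hw]
  have hτ : ∀ z : Fin n → ℂ,
      (fun b => MvPolynomial.aeval (Sum.elim z y) (τ b)) = fun b => ∑ i, (r b i : ℂ) * z i := by
    intro z
    funext b
    exact hlin (r b) z
  -- injectivity of `aeval u` on `R₀[T]`
  show Function.Injective (MvPolynomial.aeval u)
  rw [injective_iff_map_eq_zero]
  intro p hp
  obtain ⟨P, rfl⟩ := MvPolynomial.map_surjective φ.toRingHom hφsurj p
  -- `E z := R(q·z-forms…)`: evaluation of the pulled-back relation at `(z, y)`
  set Pt : MvPolynomial (Fin n ⊕ Fin n) ℚ :=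
    MvPolynomial.eval₂ (MvPolynomial.aeval (R := ℚ) σ).toRingHom τ P with hPt
  have hE : ∀ z : Fin n → ℂ, MvPolynomial.aeval (Sum.elim z y) Pt =
      MvPolynomial.eval (fun b => ∑ i, (r b i : ℂ) * z i)
        (MvPolynomial.map (MvPolynomial.aeval
          (fun v => MvPolynomial.aeval (Sum.elim z y) (σ v))).toRingHom P) := by
    intro z
    have hcomp : (MvPolynomial.aeval (Sum.elim z y)).toRingHom.comp
        (MvPolynomial.aeval (R := ℚ) σ).toRingHom =
        (MvPolynomial.aeval (fun v => MvPolynomial.aeval (Sum.elim z y) (σ v))).toRingHom := by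
      rw [← MvPolynomial.comp_aeval]
      rfl
    change (MvPolynomial.aeval (Sum.elim z y)).toRingHom Pt = _
    rw [hPt, MvPolynomial.eval₂_comp_left, hcomp, MvPolynomial.eval₂_eq_eval_map, ← hτ z]
    rfl
  -- at `z = x` the pulled-back relation is the given relation of `u` over `R₀`
  have hPx : MvPolynomial.aeval (Sum.elim x y) Pt = 0 := by
    rw [hE x, hσ x fun j => rfl, ← hp, MvPolynomial.aeval_def, MvPolynomial.eval₂_map, hφcomp,
      MvPolynomial.eval₂_eq_eval_map]
  -- hence it vanishes at `(z, y)` for every `z ∈ N`, i.e. `R(κ, T, y) = 0` for every `T`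
  have hT : ∀ T : Fin k → ℂ,
      MvPolynomial.eval T (MvPolynomial.map (MvPolynomial.aeval w).toRingHom P) = 0 := by
    intro T
    obtain ⟨v, hvq, hvr⟩ := hr (fun b => T b - u b)
    set z : Fin n → ℂ := fun i => x i + v i with hz
    have hzN : ∀ j, ∑ i, (q j i : ℂ) * z i = ∑ i, (q j i : ℂ) * x i := by
      intro j
      simp only [hz, mul_add, Finset.sum_add_distrib, hvq j, add_zero]
    have hzT : (fun b => ∑ i, (r b i : ℂ) * z i) = T := by
      funext b
      simp only [hz, mul_add, Finset.sum_add_distrib, hvr b, hu]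
      ring
    have h := hN z hzN Pt hPx
    rwa [hE z, hσ z hzN, hzT] at h
  have hzero : MvPolynomial.map (MvPolynomial.aeval w).toRingHom P = 0 :=
    MvPolynomial.funext fun T => by rw [hT T, map_zero]
  refine MvPolynomial.ext _ _ fun d => ?_
  rw [MvPolynomial.coeff_map, MvPolynomial.coeff_zero]
  apply Subtype.ext
  have h := congrArg (MvPolynomial.coeff d) hzero
  rw [MvPolynomial.coeff_map, MvPolynomial.coeff_zero] at h
  show MvPolynomial.aeval w (P.coeff d) = ((0 : R₀) : ℂ)
  rw [ZeroMemClass.coe_zero]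
  exact h

/-- **Stub 4c — the ENDGAME (registered stub of line `kernel-arithmetic-selection`, crux
stmt-Schanuel-0969, verbatim): a rational affine subspace through a first failure inside the fibre
of its own ℚ-locus is a SMALLER Schanuel counterexample.** `x` a first failure of rank `n`; `m < n`;
`q₁ … q_m` ℚ-linearly independent rational forms; every `z` with `q_j·z = q_j·x` for all `j` has
`(z, eˣ)` on the ℚ-locus of `(x, eˣ)`.  Then `False`: with `κ = q·x`, `k = n − m` and transversal
rational coordinates `u = r·x` (`exists_forms_compl`), `u` is algebraically independent over
`ℚ[κ, eˣ]` (`algebraicIndependent_of_sweep`), so `trdeg ℚ(κ, eˣ) + k ≤ trdeg ℚ(x, eˣ) < n`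
(`add_le_trdeg_adjoin_union`, monotonicity), while `e^κ` is algebraic over `ℚ(κ, eˣ)`
(`cexp_form_pow_mem`) and `SchanuelRank m` at the ℚ-independent tuple `κ`
(`linearIndependent_forms`) give `m ≤ trdeg ℚ(κ, e^κ) ≤ trdeg ℚ(κ, eˣ)` (`trdeg_le_of_isAlgebraic`):
`n = m + k < n`.  Spends `SchanuelRank m` (`m < n`), `trdeg < n` and the independence of `x`.
[cite: Kirby2010, Prop. 7.2] -/
theorem stub_endgame : ∀ (n : ℕ) (x : Fin n → ℂ), (LinearIndependent ℚ x ∧ Algebra.trdeg ℚ ↥(IntermediateField.adjoin ℚ (Set.range x ∪ Set.range (Complex.exp ∘ x))) < (n : Cardinal) ∧ ∀ r < n, Literature.NumberTheory.Transcendental.SchanuelRank r) → ∀ (m : ℕ), m < n → ∀ (q : Fin m → Fin n → ℚ), LinearIndependent ℚ q → (∀ z : Fin n → ℂ, (∀ j, ∑ i, (q j i : ℂ) * z i = ∑ i, (q j i : ℂ) * x i) → ∀ p : MvPolynomial (Fin n ⊕ Fin n) ℚ, MvPolynomial.aeval (Sum.elim x (Complex.exp ∘ x)) p = 0 → MvPolynomial.aeval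 (Sum.elim z (Complex.exp ∘ x)) p = 0) → False := by
  intro n x hx m hm q hq hN
  classical
  obtain ⟨hli, htr, hSR⟩ := hx
  obtain ⟨r, hr⟩ := exists_forms_compl q hq
  have hAI := algebraicIndependent_of_sweep x (Complex.exp ∘ x) q r hr hN
  have hκ : LinearIndependent ℚ (fun j => ∑ i, (q j i : ℂ) * x i) := linearIndependent_forms hli hq
  have hmk : m + (n - m) = n := by omega
  set y : Fin n → ℂ := Complex.exp ∘ x with hy
  set κ : Fin m → ℂ := fun j => ∑ i, (q j i : ℂ) * x i with hκdef
  set u : Fin (n - m) → ℂ := fun b => ∑ i, (r b i : ℂ) * x i with hu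
  set S₀ : Set ℂ := Set.range κ ∪ Set.range y with hS₀
  set K₀ : IntermediateField ℚ ℂ := IntermediateField.adjoin ℚ S₀ with hK₀
  set L : IntermediateField ℚ ℂ := IntermediateField.adjoin ℚ (Set.range x ∪ Set.range y) with hL
  -- `trdeg ℚ(κ, y) + k ≤ trdeg ℚ(x, y)`: `u` is algebraically independent over `ℚ(κ, y)` inside `L`
  have h2 : Algebra.trdeg ℚ K₀ + ((n - m : ℕ) : Cardinal) ≤ Algebra.trdeg ℚ L := by
    have hAI' : AlgebraicIndependent K₀ u :=
      IntermediateField.algebraicIndependent_adjoin_iff.2 hAI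
    let uK : Fin (n - m) → IntermediateField.adjoin K₀ (Set.range u) := fun b =>
      ⟨u b, IntermediateField.subset_adjoin _ _ ⟨b, rfl⟩⟩
    have hAI'' : AlgebraicIndependent K₀ uK :=
      AlgebraicIndependent.of_comp (IntermediateField.adjoin K₀ (Set.range u)).val hAI'
    have hk' : ((n - m : ℕ) : Cardinal) ≤
        Algebra.trdeg K₀ (IntermediateField.adjoin K₀ (Set.range u)) := by
      simpa using hAI''.cardinalMk_le_trdeg
    refine (add_le_trdeg_adjoin_union (K := ℚ) S₀ (Set.range u) le_rfl hk').trans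
      (trdeg_intermediateField_adjoin_mono ?_)
    have hxL : ∀ i, x i ∈ L := fun i => IntermediateField.subset_adjoin _ _ (Or.inl ⟨i, rfl⟩)
    have hformL : ∀ c : Fin n → ℚ, ∑ i, (c i : ℂ) * x i ∈ L := fun c =>
      sum_mem fun i _ => mul_mem (by exact_mod_cast SubfieldClass.ratCast_mem L (c i)) (hxL i)
    rintro s ((⟨j, rfl⟩ | ⟨i, rfl⟩) | ⟨b, rfl⟩)
    · exact hformL (q j)
    · exact IntermediateField.subset_adjoin _ _ (Or.inr ⟨i, rfl⟩)
    · exact hformL (r b)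
  -- `m ≤ trdeg ℚ(κ, e^κ) ≤ trdeg ℚ(κ, y)`: Schanuel at rank `m < n`, `e^κ` algebraic over `ℚ(κ, y)`
  have h3 : (m : Cardinal) ≤ Algebra.trdeg ℚ K₀ := by
    refine (hSR m hm κ hκ).trans ?_
    set T : Set ℂ := Set.range (cexp ∘ κ) with hT
    have hmono : Algebra.trdeg ℚ ↥(IntermediateField.adjoin ℚ (Set.range κ ∪ T)) ≤
        Algebra.trdeg ℚ ↥(IntermediateField.adjoin ℚ (S₀ ∪ T)) := by
      refine trdeg_intermediateField_adjoin_mono ?_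
      rintro s (⟨j, rfl⟩ | hs)
      · exact IntermediateField.subset_adjoin _ _ (Or.inl (Or.inl ⟨j, rfl⟩))
      · exact IntermediateField.subset_adjoin _ _ (Or.inr hs)
    refine hmono.trans
      (trdeg_le_of_isAlgebraic (IntermediateField.adjoin.mono _ _ _ subset_union_left) ?_)
    have hint : ∀ e ∈ T, IsIntegral K₀ e := by
      rintro _ ⟨j, rfl⟩
      obtain ⟨D, hD, hmem⟩ := cexp_form_pow_mem x (q j) K₀
        (fun i => IntermediateField.subset_adjoin _ _ (Or.inr ⟨i, rfl⟩))
      have h1 : IsIntegral K₀ (algebraMap K₀ ℂ ⟨_, hmem⟩) := isIntegral_algebraMap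
      exact IsIntegral.of_pow hD h1
    haveI : Algebra.IsAlgebraic K₀ (IntermediateField.adjoin K₀ T) :=
      IntermediateField.isAlgebraic_adjoin hint
    intro w hw
    rw [← IntermediateField.adjoin_adjoin_left, IntermediateField.mem_restrictScalars] at hw
    exact IntermediateField.isAlgebraic_iff.1
      (Algebra.IsAlgebraic.isAlgebraic (⟨w, hw⟩ : IntermediateField.adjoin K₀ T))
  -- the count `n = m + k ≤ trdeg ℚ(κ, y) + k ≤ trdeg ℚ(x, y) < n`
  have hmk' : ((m : Cardinal) + ((n - m : ℕ) : Cardinal)) = (n : Cardinal) := by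
    rw [← Nat.cast_add, hmk]
  have hlt : (n : Cardinal) < n :=
    calc (n : Cardinal) = m + ((n - m : ℕ) : Cardinal) := hmk'.symm
      _ ≤ Algebra.trdeg ℚ K₀ + ((n - m : ℕ) : Cardinal) := add_le_add h3 le_rfl
      _ ≤ Algebra.trdeg ℚ L := h2
      _ < n := htr
  exact lt_irrefl _ hlt

end Summit.Schanuel.Schanuel.Cruxes.MinimalCounterexampleInAcl.KernelArithmeticSelection

end
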